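import Literature.Probability.RandomPlanarGeometry.HexSAWBrickWallStripFugacityWidthOneComplexRoot
import HarnessLib

/-!
# The roots of the two-wall cubic at fugacity `ye^{it}` stay inside the disc of radius `s = μ₁(y,z)²`, with a gap `c(1 − cos t)²`

Topic `Literature/Probability/RandomPlanarGeometry` (continues `…WidthOneComplexRoot.lean`: `twoWallCubic y z ω t = ω(ω − ye^{it})(ω − z) − ye^{it}z`, whose
roots govern the coefficient asymptotics of `C_{1,N}(ye^{it}, z)` — `…WidthOneComplexDecomposition`, `…WidthOneComplexTwoTerm`).  The Berry–Esseen rate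
(`…WidthOneContactBerryEsseen`) only needs `|t| < t₀`; the LOCAL limit theorem for the contact number needs the complementary APERIODICITY input: away
from `t ∈ 2πℤ` the partition function at fugacity `ye^{it}` is exponentially smaller than at `y`.  THIS FILE proves the root-level statement behind it,
by an elementary modulus argument (no perturbation theory):

* `norm_root_le_sq` — EVERY root `ω` of the cubic at EVERY real `t` has `‖ω‖ ≤ s` (`yz = ‖ω‖·‖ω − ye^{it}‖·‖ω − z‖ ≥ P(‖ω‖)`, `P(r) = r(r−y)(r−z)`
  increasing beyond `max(y,z)` with `P(s) = yz`).
* ★★ `exists_norm_root_le_sub_gap` — there is `c = c(y,z) > 0` with `‖ω‖ ≤ s − c·(1 − cos t)²` for every real `t` and every root `ω`: equality `‖ω‖ = s`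
  forces `ω`, `ye^{it}`, `z` to be positively collinear, i.e. `t ∈ 2πℤ`; quantitatively the excess `‖ω − ye^{it}‖‖ω − z‖ − (r−y)(r−z)` is bounded below by
  `min(c₁(r − Re ω), c₂(r(1 − cos t) − (r − Re ω) − |Im ω|))`.

## Sources
N. R. Beaton, M. Bousquet-Mélou, J. de Gier, H. Duminil-Copin, A. J. Guttmann, CMP 326 (2014), arXiv:1109.0358v5 §3.2 Proposition 6 (p. 10: `μ₁(y,z)` and the
cubic law); R. Durrett, *Probability: Theory and Examples* (2019) §3.5 Theorem 3.5.2 (aperiodicity ⇒ `|φ| < 1` off the lattice — here at the level of the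
transfer roots).  Lane statements (lane «pcv-sawmu», a-p5 g28); nothing is quoted AS PRINTED.
-/

noncomputable section

open Complex
open Literature.Probability.LatticeModels Literature.Probability.Percolation

namespace Literature.Probability.RandomPlanarGeometry.SAW.HexBW

namespace WidthOneYZ

variable {y z : ℝ}

/-- The root relation in moduli: `‖ω‖·‖ω − ye^{it}‖·‖ω − z‖ = yz`. [cite: BeatonBousquetMelouDeGierDuminilCopinGuttmann2014, §3.2 Proposition 6 (arXiv v5 p. 10; lane plumbing)] -/
theorem norm_root_relation (hy : 0 < y) (hz : 0 < z) {t : ℝ} {ω : ℂ} (h : twoWallCubic y z ω t = 0) :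
    ‖ω‖ * ‖ω - (y : ℂ) * cexp ((t : ℂ) * I)‖ * ‖ω - (z : ℂ)‖ = y * z := by
  have e : ω * (ω - (y : ℂ) * cexp ((t : ℂ) * I)) * (ω - (z : ℂ)) = (y : ℂ) * (z : ℂ) * cexp ((t : ℂ) * I) := by
    unfold twoWallCubic at h; linear_combination h
  have hn := congrArg (fun q : ℂ => ‖q‖) e
  simp only [norm_mul, Complex.norm_real, Complex.norm_exp_ofReal_mul_I, mul_one, Real.norm_of_nonneg hy.le,
    Real.norm_of_nonneg hz.le] at hn
  exact hn

/-- **Every root lies in the closed disc of radius `s = μ₁(y,z)²`**, at every real `t`: if `‖ω‖ > s` then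
`yz = ‖ω‖‖ω − ye^{it}‖‖ω − z‖ ≥ ‖ω‖(‖ω‖ − y)(‖ω‖ − z) > s(s−y)(s−z) = yz`. [cite: BeatonBousquetMelouDeGierDuminilCopinGuttmann2014, §3.2 Proposition 6 (arXiv v5 p. 10; lane statement)] -/
theorem norm_root_le_sq (hy : 0 < y) (hz : 0 < z) {t : ℝ} {ω : ℂ} (h : twoWallCubic y z ω t = 0) :
    ‖ω‖ ≤ stripMuY₂ 1 y z ^ 2 := by
  set s := stripMuY₂ 1 y z ^ 2 with hs
  have hsex := stripMuY₂_one_sq_poly_eq hy hz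
  rw [← hs] at hsex
  by_contra hle'
  have hlt : s < ‖ω‖ := not_le.1 hle'
  have hms : max y z < s := max_lt_stripMuY₂_one_sq hy hz
  have hrel := norm_root_relation hy hz h
  set r := ‖ω‖ with hr
  have hP : s * (s - y) * (s - z) < r * (r - y) * (r - z) := poly_lt_poly_of_lt hms.le hlt hy
  -- but `r(r−y)(r−z) ≤ yz`
  have hry : r - y ≤ ‖ω - (y : ℂ) * cexp ((t : ℂ) * I)‖ := by
    have h1 := norm_sub_norm_le ω ((y : ℂ) * cexp ((t : ℂ) * I))
    rw [norm_mul, Complex.norm_real, Complex.norm_exp_ofReal_mul_I, mul_one, Real.norm_of_nonneg hy.le] at h1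
    exact h1
  have hrz : r - z ≤ ‖ω - (z : ℂ)‖ := by
    have h1 := norm_sub_norm_le ω (z : ℂ)
    rw [Complex.norm_real, Real.norm_of_nonneg hz.le] at h1
    exact h1
  have hy' : y < r := lt_of_le_of_lt (le_max_left y z) (hms.trans hlt)
  have hz' : z < r := lt_of_le_of_lt (le_max_right y z) (hms.trans hlt)
  have hle : r * (r - y) * (r - z) ≤ y * z := by
    rw [← hrel]
    calc r * (r - y) * (r - z) ≤ r * ‖ω - (y : ℂ) * cexp ((t : ℂ) * I)‖ * (r - z) := by
          gcongr
      _ ≤ r * ‖ω - (y : ℂ) * cexp ((t : ℂ) * I)‖ * ‖ω - (z : ℂ)‖ := by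
          gcongr
  linarith

/-- Squared distances from `ω` (`‖ω‖ = r`) to the real point `z` and to `ye^{it}`:
`‖ω − z‖² = r² − 2z·Re ω + z²`, `‖ω − ye^{it}‖² = r² − 2y(Re ω cos t + Im ω sin t) + y²`. [cite: Durrett2019, §3.5 (lane plumbing)] -/
private theorem norm_sub_sq_formulas (ω : ℂ) (y z t : ℝ) :
    ‖ω - (z : ℂ)‖ ^ 2 = ‖ω‖ ^ 2 - 2 * z * ω.re + z ^ 2 ∧
    ‖ω - (y : ℂ) * cexp ((t : ℂ) * I)‖ ^ 2 = ‖ω‖ ^ 2 - 2 * y * (ω.re * Real.cos t + ω.im * Real.sin t) + y ^ 2 := by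
  have h0 : ‖ω‖ ^ 2 = ω.re ^ 2 + ω.im ^ 2 := by rw [Complex.sq_norm, Complex.normSq_apply]; ring
  constructor
  · rw [Complex.sq_norm, Complex.normSq_apply, h0]
    simp only [Complex.sub_re, Complex.sub_im, Complex.ofReal_re, Complex.ofReal_im]
    ring
  · rw [Complex.sq_norm, Complex.normSq_apply, h0]
    have hre : ((y : ℂ) * cexp ((t : ℂ) * I)).re = y * Real.cos t := by
      rw [Complex.re_ofReal_mul, Complex.exp_ofReal_mul_I_re]
    have him : ((y : ℂ) * cexp ((t : ℂ) * I)).im = y * Real.sin t := by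
      rw [Complex.im_ofReal_mul, Complex.exp_ofReal_mul_I_im]
    simp only [Complex.sub_re, Complex.sub_im, hre, him]
    nlinarith [Real.cos_sq_add_sin_sq t]

/-- ★★ **A UNIFORM GAP OFF THE REAL AXIS.**  There is `c = c(y,z) > 0` such that for every real `t` and every root `ω` of the two-wall cubic at fugacity
`ye^{it}`: `‖ω‖ ≤ s − c·(1 − cos t)²` (`s = μ₁(y,z)²`).  Proof: `yz − r(r−y)(r−z) = (s − r)·Q` with `Q ≤ 3s² + yz`, while by the root relation
`yz − r(r−y)(r−z) ≥ r[(r−y)α + (r−z)β]` with the excesses `α = ‖ω − z‖ − (r−z) ≥ z(r − Re ω)/r`, `β = ‖ω − ye^{it}‖ − (r−y) ≥ y(r − Re(ωe^{−it}))/r`, and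
`(r − Re ω) + (r − Re(ωe^{−it})) ≳ r(1 − cos t)²`.  (For `t ∉ 2πℤ` the roots are STRICTLY inside the disc of radius `s`; the rate behind the local limit
theorem.) [cite: Durrett2019, §3.5 Theorem 3.5.2 (lane statement at the level of the transfer roots); BeatonBousquetMelouDeGierDuminilCopinGuttmann2014, §3.2 Proposition 6 (arXiv v5 p. 10)] -/
theorem exists_norm_root_le_sub_gap (hy : 0 < y) (hz : 0 < z) :
    ∃ c : ℝ, 0 < c ∧ ∀ t : ℝ, ∀ ω : ℂ, twoWallCubic y z ω t = 0 →
      ‖ω‖ ≤ stripMuY₂ 1 y z ^ 2 - c * (1 - Real.cos t) ^ 2 := by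
  set s := stripMuY₂ 1 y z ^ 2 with hs
  have hsex := stripMuY₂_one_sq_poly_eq hy hz
  rw [← hs] at hsex
  have hms : max y z < s := max_lt_stripMuY₂_one_sq hy hz
  have hys : y < s := lt_of_le_of_lt (le_max_left _ _) hms
  have hzs : z < s := lt_of_le_of_lt (le_max_right _ _) hms
  have hs0 : 0 < s := hy.trans hys
  set m := max y z with hm
  set r₁ := (s + m) / 2 with hr₁
  have hmr₁ : m < r₁ := by rw [hr₁]; linarith
  have hr₁s : r₁ < s := by rw [hr₁]; linarith
  have hyr₁ : y < r₁ := lt_of_le_of_lt (le_max_left _ _) hmr₁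
  have hzr₁ : z < r₁ := lt_of_le_of_lt (le_max_right _ _) hmr₁
  have hr₁0 : 0 < r₁ := hy.trans hyr₁
  set c₁ := (r₁ - y) * z / s with hc₁
  set c₂ := (r₁ - z) * y / s with hc₂
  have hc₁0 : 0 < c₁ := by rw [hc₁]; exact div_pos (mul_pos (sub_pos.2 hyr₁) hz) hs0
  have hc₂0 : 0 < c₂ := by rw [hc₂]; exact div_pos (mul_pos (sub_pos.2 hzr₁) hy) hs0
  set Qm := 3 * s ^ 2 + y * z with hQm
  have hQm0 : 0 < Qm := by rw [hQm]; positivity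
  set cE := min (c₁ * r₁ / 32) (c₂ * r₁ / 4) with hcE
  have hcE0 : 0 < cE := lt_min (by positivity) (by positivity)
  have hcE1 : cE ≤ c₁ * r₁ / 32 := min_le_left _ _
  have hcE2 : cE ≤ c₂ * r₁ / 4 := min_le_right _ _
  set c := min ((s - r₁) / 4) (s / Qm * cE) with hc
  have hc0 : 0 < c := lt_min (by linarith) (by positivity)
  refine ⟨c, hc0, fun t ω h => ?_⟩
  have hc4 : c ≤ (s - r₁) / 4 := min_le_left _ _
  have hcE' : c ≤ s / Qm * cE := min_le_right _ _
  clear_value c cE Qm c₁ c₂ r₁ m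
  set κ := 1 - Real.cos t with hκ
  have hκ0 : 0 ≤ κ := by rw [hκ]; linarith [Real.cos_le_one t]
  have hκ2 : κ ≤ 2 := by rw [hκ]; linarith [Real.neg_one_le_cos t]
  have hκsq : κ ^ 2 ≤ 2 * κ := by nlinarith
  have hκ4 : κ ^ 2 ≤ 4 := by nlinarith
  set r := ‖ω‖ with hr
  have hrs : r ≤ s := norm_root_le_sq hy hz h
  by_cases hrr₁ : r ≤ r₁
  · -- the trivial regime
    have : c * κ ^ 2 ≤ s - r₁ := by
      calc c * κ ^ 2 ≤ c * 4 := mul_le_mul_of_nonneg_left hκ4 hc0.le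
        _ ≤ s - r₁ := by linarith
    linarith
  · have hr₁r : r₁ < r := not_le.1 hrr₁
    have hr0 : 0 < r := hr₁0.trans hr₁r
    have hyr : y < r := hyr₁.trans hr₁r
    have hzr : z < r := hzr₁.trans hr₁r
    -- the root relation and the two distances
    have hrel := norm_root_relation hy hz h
    rw [← hr] at hrel
    obtain ⟨hA2, hB2⟩ := norm_sub_sq_formulas ω y z t
    rw [← hr] at hA2 hB2
    set A := ‖ω - (z : ℂ)‖ with hA
    set B := ‖ω - (y : ℂ) * cexp ((t : ℂ) * I)‖ with hB
    have hA0 : 0 ≤ A := norm_nonneg _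
    have hB0 : 0 ≤ B := norm_nonneg _
    clear_value A B
    -- real and imaginary parts
    set a := r - ω.re with ha
    have hreabs : |ω.re| ≤ r := by rw [hr]; exact Complex.abs_re_le_norm ω
    have hre : ω.re ≤ r := le_trans (le_abs_self _) hreabs
    have hre' : -r ≤ ω.re := neg_le_of_abs_le hreabs
    have ha0 : 0 ≤ a := by rw [ha]; linarith only [hre]
    have hsq : r ^ 2 = ω.re ^ 2 + ω.im ^ 2 := by rw [hr, Complex.sq_norm, Complex.normSq_apply]; ring
    have hIm2 : ω.im ^ 2 ≤ 2 * r * a := by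
      have e : ω.im ^ 2 = a * (r + ω.re) := by rw [ha]; linear_combination (-1 : ℝ) * hsq
      rw [e]
      calc a * (r + ω.re) ≤ a * (2 * r) := mul_le_mul_of_nonneg_left (by linarith only [hre]) ha0
        _ = 2 * r * a := by ring
    -- Cauchy–Schwarz for the projection on the direction `e^{it}`
    set cs := ω.re * Real.cos t + ω.im * Real.sin t with hcs
    have hid : cs ^ 2 + (ω.re * Real.sin t - ω.im * Real.cos t) ^ 2 = r ^ 2 := by
      rw [hcs, hsq]; linear_combination (ω.re ^ 2 + ω.im ^ 2) * Real.cos_sq_add_sin_sq t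
    have hcs2 : cs ^ 2 ≤ r ^ 2 := by linarith only [hid, sq_nonneg (ω.re * Real.sin t - ω.im * Real.cos t)]
    obtain ⟨hcslow, hcsup⟩ := abs_le_of_sq_le_sq' hcs2 hr0.le
    -- bounds on A and B
    have hAlow : r - z ≤ A := by
      have h1 : (r - z) ^ 2 ≤ A ^ 2 := by rw [hA2]; nlinarith only [hre, hz]
      exact (abs_le_of_sq_le_sq' h1 hA0).2
    have hAup : A ≤ r + z := by
      have h1 : A ^ 2 ≤ (r + z) ^ 2 := by rw [hA2]; nlinarith only [hre', hz]
      exact (abs_le_of_sq_le_sq' h1 (by linarith only [hr0, hz])).2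
    have hBlow : r - y ≤ B := by
      have h1 : (r - y) ^ 2 ≤ B ^ 2 := by rw [hB2]; nlinarith only [hcsup, hy]
      exact (abs_le_of_sq_le_sq' h1 hB0).2
    have hBup : B ≤ r + y := by
      have h1 : B ^ 2 ≤ (r + y) ^ 2 := by rw [hB2]; nlinarith only [hcslow, hy]
      exact (abs_le_of_sq_le_sq' h1 (by linarith only [hr0, hy])).2
    -- the excesses
    set α := A - (r - z) with hα
    set β := B - (r - y) with hβ
    have hα0 : 0 ≤ α := by rw [hα]; linarith only [hAlow]
    have hβ0 : 0 ≤ β := by rw [hβ]; linarith only [hBlow]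
    set b := r - cs with hb
    have hb0 : 0 ≤ b := by rw [hb]; linarith only [hcsup]
    have hαe : α * (A + (r - z)) = 2 * z * a := by rw [hα, ha]; linear_combination hA2
    have hβe : β * (B + (r - y)) = 2 * y * b := by rw [hβ, hb, hcs]; linear_combination hB2
    have hαkey : z * a ≤ α * r := by
      have h1 : α * (A + (r - z)) ≤ α * (2 * r) := mul_le_mul_of_nonneg_left (by linarith only [hAup]) hα0
      linarith only [hαe, h1]
    have hβkey : y * b ≤ β * r := by
      have h1 : β * (B + (r - y)) ≤ β * (2 * r) := mul_le_mul_of_nonneg_left (by linarith only [hBup]) hβ0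
      linarith only [hβe, h1]
    -- the excess feeds the gap: (s − r)·Qm ≥ (r−y)·z·a + (r−z)·y·b
    have hgap1 : (r - y) * (z * a) + (r - z) * (y * b) ≤ (s - r) * Qm := by
      have hP : y * z = r * ((r - y + β) * (r - z + α)) := by rw [← hrel, hα, hβ]; ring
      have hQ : y * z - r * (r - y) * (r - z) = (s - r) * (s ^ 2 + s * r + r ^ 2 - (y + z) * (s + r) + y * z) := by
        linear_combination (-1 : ℝ) * hsex
      have hQle : s ^ 2 + s * r + r ^ 2 - (y + z) * (s + r) + y * z ≤ Qm := by
        rw [hQm]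
        have h1 : s * r ≤ s ^ 2 := by nlinarith only [hrs, hs0]
        have h2 : r ^ 2 ≤ s ^ 2 := by nlinarith only [hrs, hr0]
        have h3 : 0 ≤ (y + z) * (s + r) := by positivity
        linarith only [h1, h2, h3]
      have hsr : 0 ≤ s - r := sub_nonneg.2 hrs
      have hprod : 0 ≤ r * α * β := mul_nonneg (mul_nonneg hr0.le hα0) hβ0
      have h1 : r * ((r - y) * α + (r - z) * β) ≤ y * z - r * (r - y) * (r - z) := by
        rw [hP]; nlinarith only [hprod]
      have h2 : (r - y) * (z * a) + (r - z) * (y * b) ≤ r * ((r - y) * α + (r - z) * β) := by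
        have e1 := mul_le_mul_of_nonneg_left hαkey (sub_pos.2 hyr).le
        have e2 := mul_le_mul_of_nonneg_left hβkey (sub_pos.2 hzr).le
        linarith only [e1, e2]
      calc (r - y) * (z * a) + (r - z) * (y * b) ≤ y * z - r * (r - y) * (r - z) := h2.trans h1
        _ = (s - r) * (s ^ 2 + s * r + r ^ 2 - (y + z) * (s + r) + y * z) := hQ
        _ ≤ (s - r) * Qm := mul_le_mul_of_nonneg_left hQle hsr
    have hgap2 : s * (c₁ * a + c₂ * b) ≤ (s - r) * Qm := by
      have e : s * (c₁ * a + c₂ * b) = (r₁ - y) * (z * a) + (r₁ - z) * (y * b) := by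
        rw [hc₁, hc₂]; field_simp
      rw [e]
      refine le_trans ?_ hgap1
      have h1 : (r₁ - y) * (z * a) ≤ (r - y) * (z * a) :=
        mul_le_mul_of_nonneg_right (by linarith only [hr₁r]) (mul_nonneg hz.le ha0)
      have h2 : (r₁ - z) * (y * b) ≤ (r - z) * (y * b) :=
        mul_le_mul_of_nonneg_right (by linarith only [hr₁r]) (mul_nonneg hy.le hb0)
      linarith only [h1, h2]
    -- the collinearity estimate: c₁ a + c₂ b ≥ cE κ²
    have hκr : cE * κ ^ 2 ≤ c₁ * a + c₂ * b := by
      by_cases hcase : r * κ ^ 2 / 32 ≤ a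
      · -- `a` is large
        have h1 : cE * κ ^ 2 ≤ c₁ * r₁ / 32 * κ ^ 2 := mul_le_mul_of_nonneg_right hcE1 (sq_nonneg _)
        have h0 : r₁ * κ ^ 2 ≤ r * κ ^ 2 := mul_le_mul_of_nonneg_right hr₁r.le (sq_nonneg _)
        have h2 : c₁ * r₁ / 32 * κ ^ 2 ≤ c₁ * a := by
          have : r₁ / 32 * κ ^ 2 ≤ a := by linarith only [h0, hcase]
          calc c₁ * r₁ / 32 * κ ^ 2 = c₁ * (r₁ / 32 * κ ^ 2) := by ring
            _ ≤ c₁ * a := mul_le_mul_of_nonneg_left this hc₁0.le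
        have h3 : 0 ≤ c₂ * b := mul_nonneg hc₂0.le hb0
        linarith only [h1, h2, h3]
      · -- `a` is small: `ω` is close to the positive real axis, so `b ≥ rκ/2`
        have hasmall : a < r * κ ^ 2 / 32 := not_le.1 hcase
        have hIm : |ω.im| ≤ r * κ / 4 := by
          have h1 : ω.im ^ 2 ≤ (r * κ / 4) ^ 2 := by
            calc ω.im ^ 2 ≤ 2 * r * a := hIm2
              _ ≤ 2 * r * (r * κ ^ 2 / 32) := mul_le_mul_of_nonneg_left hasmall.le (by positivity)
              _ = (r * κ / 4) ^ 2 := by ring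
          exact abs_le.2 (abs_le_of_sq_le_sq' h1 (by positivity))
        have hsin : ω.im * Real.sin t ≤ |ω.im| := by
          calc ω.im * Real.sin t ≤ |ω.im * Real.sin t| := le_abs_self _
            _ = |ω.im| * |Real.sin t| := abs_mul _ _
            _ ≤ |ω.im| * 1 := mul_le_mul_of_nonneg_left (Real.abs_sin_le_one t) (abs_nonneg _)
            _ = |ω.im| := mul_one _
        have hcos : -a ≤ a * Real.cos t := by nlinarith only [Real.neg_one_le_cos t, ha0]
        have ha16 : a ≤ r * κ / 16 := by
          have : r * κ ^ 2 / 32 ≤ r * κ / 16 := by nlinarith only [hr0, hκsq]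
          linarith only [hasmall, this]
        have hbform : b = r * κ + a * Real.cos t - ω.im * Real.sin t := by
          rw [hb, hcs, hκ, ha]; ring
        have hblow : r * κ / 2 ≤ b := by
          rw [hbform]
          have hrκ : 0 ≤ r * κ := mul_nonneg hr0.le hκ0
          linarith only [hsin, hcos, ha16, hIm, hrκ]
        have h1 : cE * κ ^ 2 ≤ c₂ * r₁ / 4 * κ ^ 2 := mul_le_mul_of_nonneg_right hcE2 (sq_nonneg _)
        have h2 : c₂ * r₁ / 4 * κ ^ 2 ≤ c₂ * b := by
          have h3 : r₁ * κ / 2 ≤ b := by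
            have : r₁ * κ ≤ r * κ := mul_le_mul_of_nonneg_right hr₁r.le hκ0
            linarith only [this, hblow]
          have h4 : r₁ / 4 * κ ^ 2 ≤ r₁ * κ / 2 := by nlinarith only [hr₁0, hκsq]
          calc c₂ * r₁ / 4 * κ ^ 2 = c₂ * (r₁ / 4 * κ ^ 2) := by ring
            _ ≤ c₂ * b := mul_le_mul_of_nonneg_left (h4.trans h3) hc₂0.le
        have h3 : 0 ≤ c₁ * a := mul_nonneg hc₁0.le ha0
        linarith only [h1, h2, h3]
    -- conclusion
    have hfin : c * κ ^ 2 ≤ s - r := by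
      have h1 : c * κ ^ 2 ≤ s / Qm * cE * κ ^ 2 := mul_le_mul_of_nonneg_right hcE' (sq_nonneg _)
      have h2 : s / Qm * cE * κ ^ 2 ≤ s - r := by
        rw [show s / Qm * cE * κ ^ 2 = s * (cE * κ ^ 2) / Qm by ring, div_le_iff₀ hQm0]
        calc s * (cE * κ ^ 2) ≤ s * (c₁ * a + c₂ * b) := mul_le_mul_of_nonneg_left hκr hs0.le
          _ ≤ (s - r) * Qm := hgap2
      linarith only [h1, h2]
    linarith only [hfin]

end WidthOneYZ

end Literature.Probability.RandomPlanarGeometry.SAW.HexBW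

end
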